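/-
Copyright (c) 2026 the pub-hodgecm-mathlib formalisation cell (harness21).  Prover seat hodgecm-mathlib-F0P3-p03 (g15): road «S3-ram» (LEAD F0P3a-plan (g12); owner
F0P3a-p06 (g15)); junction J-PACK v2 (pen F0P3a-p01 (g17)), ROW-R «REGULAR DEPTH-ONE VERTEX» (handed over by F0P2-p01 (g15) 2026-09-02T01:12:28Z); 2026-09-02.
-/
import Literature.NumberTheory.Automorphic.UnitaryLatticeTreeFixedRowEvenRamified   -- ★ ROW-E p847526 (F0P2-p01 (g15)): the template, `conj_mul_eq_inv_mul_conj_mul`; brings ★ M₂∕M∕L∕K∕J∕I∕H∕G′∕G∕F∕E∕D, ★ G3⁺ p847297, ★ G3⁵ p847483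
import HarnessLib

/-!
# The lattice graph of a hermitian space — ROW-R OF THE TREE INDUCTION (tame-ramified place): the fixed grandchildren of a REGULAR DEPTH-ONE vertex `R = O₀` are `q`
# vertices of depth `0` (the `bd` stratum) (Bruhat–Tits 1972 §10; Tits 1979 §3.5; Kottwitz 1986 §3)

Topic `NumberTheory/Automorphic`; namespace `Literature.NumberTheory.Automorphic.UnitaryLatticeTree`.  THEOREMS ONLY (no definition, no instance, no notation, no named fact,
no `sorry`); kernel lane `--supports stmt-HodgeConjecture-24833`.  Cell `pub/hodgecm-mathlib` (D-0151), crux H413; road «S3-ram» (Literature seeding, count-neutral), organ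
A′ (ii) of the P-1-ram skeleton (architect A-p16 (g31)); junction J-PACK v2 (F0P3a-p01 (g17)) **ROW-R** «REGULAR DEPTH-ONE VERTEX», the `hR` hypothesis of the tree-induction
engine ★ p847302 in TOKEN currency (socket `row_R` of the junction skeleton v2 :53, binders VERBATIM).  J₀-MODEL.  Twin of ★ ROW-E (`UnitaryLatticeTreeFixedRowEvenRamified`,
F0P2-p01 (g15)) at ODD depth `d = 1` and rank two.

THE STATEMENT.  For a fixed self-dual vertex `v ≠ r₀` of depth EXACTLY `1` (`LEV[v] ϖ`, `¬LEV[v](ϖ²)`), rank two (`¬LEV₂[v](ϖ³)`) and residually nilpotent (`LEV₃[v](ϖ⁴)`) —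
the label `R = O₀ = (1, 2)` — oriented by `(p, g, hup)`: **every fixed grandchild `w ∈ GC(v)` has `¬LEV[w] ϖ`** (depth `0`, the `bd` leaves `B`) **and `#GC(v) = q`** — the law
`R → q·B` of the shell recursion (CERT smoke v1.3 §6; B-p14 (g39) kill-check «`R` q·`B`»).

THE PROOF.  `v = u·L₀` (★ transitivity); in the frame `u₀ = uκ₀` adapted to the inward line (★ L) the element `Y₀ = u₀⁻¹(γ−1)u₀` has level `ϖ`, first column `≡ 0 (mod ϖ²)` (★ J:
`hup` makes the inward line an eigenline, nilpotency makes it a kernel line), `Y₀³ ≡ 0 (mod ϖ⁴)` and `Y₀² ≢ 0 (mod ϖ³)`; by ★ M (ODD shape) `Ȳ₀ = a(E₀₁ + E₁₂) + bE₀₂` with the pivots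
`|Y₀ 0 1| = |Y₀ 1 2| = |ϖ|` — REGULAR NILPOTENT with kernel the inward line.  LABELS: a grandchild `w = latt((uκ)·g(a,b))` lies over an OUTWARD neighbour `c = (uκ)·N₁ ≠ p`, so
`k = κ₀⁻¹κ` moves `N₁` and the kernel test (★ M₂) says the first column of `k⁻¹Y₀k` does NOT vanish mod `ϖ²` (the line of `c` is off `ker Ȳ`); `w` FIXED gives `LEV[w](ϖ⁰)`, i.e.
the corner passes (★ H `map_sub_one_childLatt_le_scaleLattice_pred_iff` at `d = 1`); hence ★ J `not_lev_and_not_lev₂_childLatt_of_cube_le`: `¬LEV[w] ϖ`.  COUNT: ★ G3⁺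
`#GC(v) = q·#{passing children}` and `#{passing children} + 1 = #{passing neighbours}`; a neighbour `(uκ)·N₁` passes iff its line is `Q_Ȳ`-null (★ G3⁺
`forall_fixed_neighbor_iff_v_B₀_lt_one_of_congr`), and a REGULAR nilpotent `Ȳ` kills exactly TWO isotropic lines (★ G3⁵ `ncard_neighborSet_null_eq_two_of_tokens`): `2 − 1 = 1`
passing child, `#GC(v) = q`.

* `map_sub_one_le_scaleLattice_pow_zero_of_latticeGraphIso_eq` (a fixed vertex has `LEV(ϖ⁰)`), `setOf_passingNeighbors_eq_setOf_nullLine` (passing neighbours = null-line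
  neighbours at level `ϖ`), **`fixedGrandchildren_not_lev_and_ncard_of_regular_one`** (ROW-R).

HONEST LABEL: HC_CM is proved only modulo the 2 remaining named inputs (hLiu418 24832, h413 24833) until rung 0 closes; nothing printed is asserted here (elementary lattice
bookkeeping over a valuation ring); «S3-ram» has no books consequence.

## References
* [BruhatTits1972] F. Bruhat, J. Tits, *Groupes réductifs sur un corps local I*, Publ. Math. IHÉS 41 (1972), §10 (lattice models; vertex stabilisers and their filtrations).
* [Tits1979] J. Tits, *Reductive groups over local fields*, PSPM 33.1 (1979), §3.5 (congruence filtration; reduction mod `𝔭`).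
* [Kottwitz1986] R. E. Kottwitz, *Base change for unit elements of Hecke algebras*, Compositio Math. 60 (1986), §3 (counting fixed lattices shell by shell).
* [Serre1980Trees] J.-P. Serre, *Trees* (1980), Ch. I §2.3, Ch. II §1.1 (rooted trees; neighbours of a lattice).
-/

set_option autoImplicit false

noncomputable section

open scoped Valued WithZero Matrix MatrixGroups

namespace Literature.NumberTheory.Automorphic.UnitaryLatticeTree

open Literature.NumberTheory.Automorphic Literature.NumberTheory.Automorphic.HermitianLattice

variable {K : Type*} [Field K] [Valued K ℤᵐ⁰] {σ : K →+* K} {ϖ : K}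

/-- **A FIXED VERTEX HAS `LEV(ϖ⁰)`**: if `γ·w = w` then `(γ − 1)·w ⊆ w = ϖ⁰·w`. [cite: Serre1980Trees, II.1.1] -/
theorem map_sub_one_le_scaleLattice_pow_zero_of_latticeGraphIso_eq {N : ℕ} {H : Matrix (Fin N) (Fin N) K} (γ : unitaryGroupOfForm σ H)
    {w : {M : Submodule 𝒪[K] (Fin N → K) // IsVertex σ ϖ H M}} (hfix : latticeGraphIso σ ϖ H γ w = w) :
    w.1.map ((Matrix.toLin' (((γ : GL (Fin N) K) : Matrix (Fin N) (Fin N) K) - 1)).restrictScalars 𝒪[K]) ≤ scaleLattice (ϖ ^ 0) w.1 := by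
  rw [latticeGraphIso_eq_iff_mapGL_eq] at hfix
  rintro _ ⟨x, hx, rfl⟩
  rw [pow_zero, mem_scaleLattice_iff one_ne_zero, inv_one, one_smul, LinearMap.restrictScalars_apply, Matrix.toLin'_apply, Matrix.sub_mulVec, Matrix.one_mulVec]
  refine w.1.sub_mem ?_ hx
  have hmem : ((γ : GL (Fin N) K) : Matrix (Fin N) (Fin N) K) *ᵥ x ∈ mapGL (γ : GL (Fin N) K) w.1 :=
    Submodule.mem_map_of_mem (f := ((Matrix.toLin' ((γ : GL (Fin N) K) : Matrix (Fin N) (Fin N) K)).restrictScalars 𝒪[K])) hx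
  rwa [hfix] at hmem

/-- **PASSING NEIGHBOURS = NULL-LINE NEIGHBOURS (level `ϖ`).**  At `v = u·L₀` fixed by `γ` with `(γ − 1)·v ⊆ ϖ·v`: a neighbour `(uκ)·N₁` (`κ ∈ K₀`) has ALL its neighbours
fixed iff its line `κe₀` is `Q_Ȳ`-null (★ G3⁺ `forall_fixed_neighbor_iff_v_B₀_lt_one_of_congr`), i.e. the set of passing neighbours is ★ G3⁵'s null-line set at `d = 1`.
[cite: BruhatTits1972, §10] [cite: Tits1979, §3.5] [cite: Kottwitz1986, §3] -/
theorem setOf_passingNeighbors_eq_setOf_nullLine (hσ : ∀ x, σ (σ x) = x) (hvσ : ∀ a, Valued.v (σ a) = Valued.v a) (hσϖ : σ ϖ = -ϖ)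
    (hϖ : Valued.v ϖ = WithZero.exp (-1 : ℤ)) (hres : ∀ x : K, Valued.v x ≤ 1 → Valued.v (σ x - x) < 1) (h2 : Valued.v (2 : K) = 1) [Finite 𝓀[K]]
    (γ u : unitaryGroupOfForm σ ((StdForm.antidiagonal 3).over K))
    (hfix : latticeGraphIso σ ϖ ((StdForm.antidiagonal 3).over K) γ (latticeGraphIso σ ϖ ((StdForm.antidiagonal 3).over K) u ⟨stdLattice K 3, 0, isSelfDualLattice_stdLattice_three_of_v hϖ⟩) = latticeGraphIso σ ϖ ((StdForm.antidiagonal 3).over K) u ⟨stdLattice K 3, 0, isSelfDualLattice_stdLattice_three_of_v hϖ⟩)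
    (hlev : (latticeGraphIso σ ϖ ((StdForm.antidiagonal 3).over K) u ⟨stdLattice K 3, 0, isSelfDualLattice_stdLattice_three_of_v hϖ⟩).1.map ((Matrix.toLin' (((γ : GL (Fin 3) K) : Matrix (Fin 3) (Fin 3) K) - 1)).restrictScalars 𝒪[K]) ≤
      scaleLattice (ϖ ^ 1) (latticeGraphIso σ ϖ ((StdForm.antidiagonal 3).over K) u ⟨stdLattice K 3, 0, isSelfDualLattice_stdLattice_three_of_v hϖ⟩).1) :
    {c | c ∈ (latticeGraph σ ϖ ((StdForm.antidiagonal 3).over K)).neighborSet (latticeGraphIso σ ϖ ((StdForm.antidiagonal 3).over K) u ⟨stdLattice K 3, 0, isSelfDualLattice_stdLattice_three_of_v hϖ⟩) ∧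
        ∀ w ∈ (latticeGraph σ ϖ ((StdForm.antidiagonal 3).over K)).neighborSet c, latticeGraphIso σ ϖ ((StdForm.antidiagonal 3).over K) γ w = w} =
    {c | c ∈ (latticeGraph σ ϖ ((StdForm.antidiagonal 3).over K)).neighborSet (latticeGraphIso σ ϖ ((StdForm.antidiagonal 3).over K) u ⟨stdLattice K 3, 0, isSelfDualLattice_stdLattice_three_of_v hϖ⟩) ∧
        ∃ κ : unitaryGroupOfForm σ ((StdForm.antidiagonal 3).over K), κ ∈ unitaryInt σ ((StdForm.antidiagonal 3).over K) ∧
          c.1 = mapGL (((u * κ : unitaryGroupOfForm σ ((StdForm.antidiagonal 3).over K)) : GL (Fin 3) K)) (latt (Matrix.diagonal ![(1 : K), 1, ϖ])) ∧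
          ∃ t : 𝒪[K], (t : K) = (ϖ ^ 1)⁻¹ * B₀ σ 3 (((κ : GL (Fin 3) K) : Matrix (Fin 3) (Fin 3) K) *ᵥ (Pi.single 0 1))
              (((((u⁻¹ * γ * u : unitaryGroupOfForm σ ((StdForm.antidiagonal 3).over K)) : GL (Fin 3) K) : Matrix (Fin 3) (Fin 3) K) - 1) *ᵥ
                (((κ : GL (Fin 3) K) : Matrix (Fin 3) (Fin 3) K) *ᵥ (Pi.single 0 1))) ∧ IsLocalRing.residue 𝒪[K] t = 0} := by
  have hϖ0 : ϖ ≠ 0 := fun h0 => by rw [h0, map_zero] at hϖ; exact WithZero.coe_ne_zero hϖ.symm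
  have hγK : u⁻¹ * γ * u ∈ unitaryInt σ ((StdForm.antidiagonal 3).over K) := mem_unitaryInt_conj_of_latticeGraphIso_apply_root_eq hfix
  have hγϖ : ∀ i j, Valued.v (((((u⁻¹ * γ * u : unitaryGroupOfForm σ ((StdForm.antidiagonal 3).over K)) : GL (Fin 3) K) : Matrix (Fin 3) (Fin 3) K) - 1) i j) ≤ Valued.v ϖ := by
    have h := (forall_v_conj_sub_one_le_iff_map_sub_one_le_scaleLattice γ u (pow_ne_zero 1 hϖ0)).1 hlev
    simpa only [pow_one] using h
  ext c
  simp only [Set.mem_setOf_eq]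
  constructor
  · rintro ⟨hc, hpass⟩
    obtain ⟨κ, hκ, hcκ⟩ := (mem_neighborSet_latticeGraphIso_root_iff hσ hvσ hσϖ hϖ h2 u c).1 hc
    have htest := (forall_fixed_neighbor_iff_v_B₀_lt_one_of_congr hvσ hσϖ hϖ hres hγK hκ hγϖ).1 (by rw [← hcκ]; exact hpass)
    rw [col_zero_eq_mulVec_single] at htest
    refine ⟨hc, κ, hκ, by rw [hcκ, latticeGraphIso_apply_val], ⟨_, le_of_lt htest⟩, by rw [pow_one], ?_⟩
    rw [residue_eq_zero_iff_v_lt_one]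
    exact htest
  · rintro ⟨hc, κ, hκ, hc1, t, ht, ht0⟩
    have hcκ : c = latticeGraphIso σ ϖ ((StdForm.antidiagonal 3).over K) (u * κ) ⟨latt (Matrix.diagonal ![(1 : K), 1, ϖ]), 2, isVertexLattice_two_N₁_of_neg hσϖ hϖ⟩ :=
      Subtype.ext (by rw [latticeGraphIso_apply_val]; exact hc1)
    refine ⟨hc, ?_⟩
    rw [hcκ]
    refine (forall_fixed_neighbor_iff_v_B₀_lt_one_of_congr hvσ hσϖ hϖ hres hγK hκ hγϖ).2 ?_
    rw [col_zero_eq_mulVec_single, ← pow_one ϖ, ← ht]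
    exact (residue_eq_zero_iff_v_lt_one t).1 ht0

/-- **ROW-R «REGULAR DEPTH-ONE VERTEX `R = O₀`»** of the (a2) tree induction, token currency (J-PACK v2 §2, socket `row_R` VERBATIM): for a fixed self-dual vertex `v ≠ r₀` of depth
exactly `1` (`LEV[v] ϖ`, `¬LEV[v](ϖ²)`), rank two (`¬LEV₂[v](ϖ³)`), residually nilpotent (`LEV₃[v](ϖ⁴)`), oriented (`p` the inward neighbour, `g ≠ v` a vertex through `p` with
`LEV[g] ϖ`): every fixed grandchild `w ∈ GC(v)` satisfies `¬LEV[w] ϖ` (depth `0`), and `#GC(v) = q`.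
[cite: Kottwitz1986, §3] [cite: Tits1979, §3.5] [cite: BruhatTits1972, §10] [cite: Serre1980Trees, I.2.3, II.1.1] -/
theorem fixedGrandchildren_not_lev_and_ncard_of_regular_one (hσ : ∀ x, σ (σ x) = x) (hvσ : ∀ a, Valued.v (σ a) = Valued.v a) (hσϖ : σ ϖ = -ϖ)
    (hϖ : Valued.v ϖ = WithZero.exp (-1 : ℤ)) (hres : ∀ x : K, Valued.v x ≤ 1 → Valued.v (σ x - x) < 1) (h2 : Valued.v (2 : K) = 1) [Finite 𝓀[K]]
    (hT : (latticeGraph σ ϖ ((StdForm.antidiagonal 3).over K)).IsTree)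
    {γ : unitaryGroupOfForm σ ((StdForm.antidiagonal 3).over K)} (hγ0 : γ ∈ unitaryInt σ ((StdForm.antidiagonal 3).over K))
    {v : {M : Submodule 𝒪[K] (Fin 3 → K) // IsVertex σ ϖ ((StdForm.antidiagonal 3).over K) M}}
    (hv : IsSelfDualLattice σ ϖ ((StdForm.antidiagonal 3).over K) v.1) (hvr : v ≠ ⟨stdLattice K 3, 0, isSelfDualLattice_stdLattice_three_of_v hϖ⟩)
    (hfix : latticeGraphIso σ ϖ ((StdForm.antidiagonal 3).over K) γ v = v)
    {p g : {M : Submodule 𝒪[K] (Fin 3 → K) // IsVertex σ ϖ ((StdForm.antidiagonal 3).over K) M}}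
    (hp : (latticeGraph σ ϖ ((StdForm.antidiagonal 3).over K)).Adj v p) (hpin : (latticeGraph σ ϖ ((StdForm.antidiagonal 3).over K)).dist ⟨stdLattice K 3, 0, isSelfDualLattice_stdLattice_three_of_v hϖ⟩ p + 1 = (latticeGraph σ ϖ ((StdForm.antidiagonal 3).over K)).dist ⟨stdLattice K 3, 0, isSelfDualLattice_stdLattice_three_of_v hϖ⟩ v) (hg : (latticeGraph σ ϖ ((StdForm.antidiagonal 3).over K)).Adj p g) (hgv : g ≠ v)
    (hup : g.1.map ((Matrix.toLin' (((γ : GL (Fin 3) K) : Matrix (Fin 3) (Fin 3) K) - 1)).restrictScalars 𝒪[K]) ≤ scaleLattice (ϖ) g.1)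
    (hlev : v.1.map ((Matrix.toLin' (((γ : GL (Fin 3) K) : Matrix (Fin 3) (Fin 3) K) - 1)).restrictScalars 𝒪[K]) ≤ scaleLattice (ϖ) v.1) (hlev2 : ¬ v.1.map ((Matrix.toLin' (((γ : GL (Fin 3) K) : Matrix (Fin 3) (Fin 3) K) - 1)).restrictScalars 𝒪[K]) ≤ scaleLattice (ϖ ^ 2) v.1) (hrk : ¬ v.1.map ((Matrix.toLin' ((((γ : GL (Fin 3) K) : Matrix (Fin 3) (Fin 3) K) - 1) ^ 2)).restrictScalars 𝒪[K]) ≤ scaleLattice (ϖ ^ 3) v.1) (hnil : v.1.map ((Matrix.toLin' ((((γ : GL (Fin 3) K) : Matrix (Fin 3) (Fin 3) K) - 1) ^ 3)).restrictScalars 𝒪[K]) ≤ scaleLattice (ϖ ^ 4) v.1) :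
    (∀ w ∈ {w | ∃ c, ((latticeGraph σ ϖ ((StdForm.antidiagonal 3).over K)).Adj v c ∧
          (latticeGraph σ ϖ ((StdForm.antidiagonal 3).over K)).dist ⟨stdLattice K 3, 0, isSelfDualLattice_stdLattice_three_of_v hϖ⟩ c =
            (latticeGraph σ ϖ ((StdForm.antidiagonal 3).over K)).dist ⟨stdLattice K 3, 0, isSelfDualLattice_stdLattice_three_of_v hϖ⟩ v + 1 ∧
          latticeGraphIso σ ϖ ((StdForm.antidiagonal 3).over K) γ c = c) ∧
        ((latticeGraph σ ϖ ((StdForm.antidiagonal 3).over K)).Adj c w ∧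
          (latticeGraph σ ϖ ((StdForm.antidiagonal 3).over K)).dist ⟨stdLattice K 3, 0, isSelfDualLattice_stdLattice_three_of_v hϖ⟩ w =
            (latticeGraph σ ϖ ((StdForm.antidiagonal 3).over K)).dist ⟨stdLattice K 3, 0, isSelfDualLattice_stdLattice_three_of_v hϖ⟩ c + 1 ∧
          latticeGraphIso σ ϖ ((StdForm.antidiagonal 3).over K) γ w = w)}, ¬ w.1.map ((Matrix.toLin' (((γ : GL (Fin 3) K) : Matrix (Fin 3) (Fin 3) K) - 1)).restrictScalars 𝒪[K]) ≤ scaleLattice (ϖ) w.1) ∧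
      ({w | ∃ c, ((latticeGraph σ ϖ ((StdForm.antidiagonal 3).over K)).Adj v c ∧
          (latticeGraph σ ϖ ((StdForm.antidiagonal 3).over K)).dist ⟨stdLattice K 3, 0, isSelfDualLattice_stdLattice_three_of_v hϖ⟩ c =
            (latticeGraph σ ϖ ((StdForm.antidiagonal 3).over K)).dist ⟨stdLattice K 3, 0, isSelfDualLattice_stdLattice_three_of_v hϖ⟩ v + 1 ∧
          latticeGraphIso σ ϖ ((StdForm.antidiagonal 3).over K) γ c = c) ∧
        ((latticeGraph σ ϖ ((StdForm.antidiagonal 3).over K)).Adj c w ∧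
          (latticeGraph σ ϖ ((StdForm.antidiagonal 3).over K)).dist ⟨stdLattice K 3, 0, isSelfDualLattice_stdLattice_three_of_v hϖ⟩ w =
            (latticeGraph σ ϖ ((StdForm.antidiagonal 3).over K)).dist ⟨stdLattice K 3, 0, isSelfDualLattice_stdLattice_three_of_v hϖ⟩ c + 1 ∧
          latticeGraphIso σ ϖ ((StdForm.antidiagonal 3).over K) γ w = w)}).ncard = Nat.card 𝓀[K] := by
  have hϖ0 : ϖ ≠ 0 := fun h0 => by rw [h0, map_zero] at hϖ; exact WithZero.coe_ne_zero hϖ.symm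
  have hvϖ0 : Valued.v ϖ ≠ 0 := (Valuation.ne_zero_iff _).2 hϖ0
  have hϖlt : Valued.v ϖ < 1 := by rw [hϖ, ← WithZero.exp_zero]; exact WithZero.exp_lt_exp.2 (by norm_num)
  have hd1 : 1 ≤ (1 : ℕ) := le_rfl
  have hodd : Odd (1 : ℕ) := odd_one
  -- tokens in `ϖ ^ 1` ∕ `ϖ ^ (k*1+1)` spelling
  have hlev1 : v.1.map ((Matrix.toLin' (((γ : GL (Fin 3) K) : Matrix (Fin 3) (Fin 3) K) - 1)).restrictScalars 𝒪[K]) ≤ scaleLattice (ϖ ^ 1) v.1 := by rw [pow_one]; exact hlev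
  have hup1 : g.1.map ((Matrix.toLin' (((γ : GL (Fin 3) K) : Matrix (Fin 3) (Fin 3) K) - 1)).restrictScalars 𝒪[K]) ≤ scaleLattice (ϖ ^ 1) g.1 := by rw [pow_one]; exact hup
  have hrk1 : ¬ v.1.map ((Matrix.toLin' ((((γ : GL (Fin 3) K) : Matrix (Fin 3) (Fin 3) K) - 1) ^ 2)).restrictScalars 𝒪[K]) ≤ scaleLattice (ϖ ^ (2 * 1 + 1)) v.1 := by simpa using hrk
  have hnil1 : v.1.map ((Matrix.toLin' ((((γ : GL (Fin 3) K) : Matrix (Fin 3) (Fin 3) K) - 1) ^ 3)).restrictScalars 𝒪[K]) ≤ scaleLattice (ϖ ^ (3 * 1 + 1)) v.1 := by simpa using hnil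
  -- the frame of `v`
  obtain ⟨u, hu⟩ := exists_latticeGraphIso_root_eq_of_v_two hσ hvσ hϖ h2 v hv (isSelfDualLattice_stdLattice_three_of_v hϖ)
  subst hu
  have hframe : ∀ {κ : unitaryGroupOfForm σ ((StdForm.antidiagonal 3).over K)}, κ ∈ unitaryInt σ ((StdForm.antidiagonal 3).over K) →
      latticeGraphIso σ ϖ ((StdForm.antidiagonal 3).over K) (u * κ) ⟨stdLattice K 3, 0, isSelfDualLattice_stdLattice_three_of_v hϖ⟩ = latticeGraphIso σ ϖ ((StdForm.antidiagonal 3).over K) u ⟨stdLattice K 3, 0, isSelfDualLattice_stdLattice_three_of_v hϖ⟩ := fun {κ} hκ => by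
    rw [latticeGraphIso_mul_apply, latticeGraphIso_root_eq_of_mem_unitaryInt hϖ hκ]
  -- token ↔ matrix dictionary in the frame `u * κ`, powers `1`, `2`, `3`
  have hY : ∀ {κ : unitaryGroupOfForm σ ((StdForm.antidiagonal 3).over K)}, κ ∈ unitaryInt σ ((StdForm.antidiagonal 3).over K) →
      ∀ i j, Valued.v ((((((u * κ)⁻¹ * γ * (u * κ) : unitaryGroupOfForm σ ((StdForm.antidiagonal 3).over K)) : GL (Fin 3) K) : Matrix (Fin 3) (Fin 3) K) - 1) i j) ≤
        Valued.v ϖ ^ 1 := fun {κ} hκ => by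
    have h := (map_pow_le_scaleLattice_latticeGraphIso_root_iff hϖ γ (u * κ) (pow_ne_zero 1 hϖ0) 1).1 (by rw [pow_one, hframe hκ]; exact hlev1)
    simpa only [pow_one, map_pow] using h
  have hY2ne : ∀ {κ : unitaryGroupOfForm σ ((StdForm.antidiagonal 3).over K)}, κ ∈ unitaryInt σ ((StdForm.antidiagonal 3).over K) →
      ¬ ∀ i j, Valued.v (((((((u * κ)⁻¹ * γ * (u * κ) : unitaryGroupOfForm σ ((StdForm.antidiagonal 3).over K)) : GL (Fin 3) K) : Matrix (Fin 3) (Fin 3) K) - 1) *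
        (((((u * κ)⁻¹ * γ * (u * κ) : unitaryGroupOfForm σ ((StdForm.antidiagonal 3).over K)) : GL (Fin 3) K) : Matrix (Fin 3) (Fin 3) K) - 1)) i j) ≤
        Valued.v ϖ ^ (2 * 1 + 1) := fun {κ} hκ h => by
    apply hrk1
    have h' := (map_pow_le_scaleLattice_latticeGraphIso_root_iff hϖ γ (u * κ) (pow_ne_zero (2 * 1 + 1) hϖ0) 2).2 (by simpa only [pow_two, map_pow] using h)
    rwa [hframe hκ] at h'
  have hY3 : ∀ {κ : unitaryGroupOfForm σ ((StdForm.antidiagonal 3).over K)}, κ ∈ unitaryInt σ ((StdForm.antidiagonal 3).over K) →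
      ∀ i j, Valued.v (((((((u * κ)⁻¹ * γ * (u * κ) : unitaryGroupOfForm σ ((StdForm.antidiagonal 3).over K)) : GL (Fin 3) K) : Matrix (Fin 3) (Fin 3) K) - 1) *
        (((((u * κ)⁻¹ * γ * (u * κ) : unitaryGroupOfForm σ ((StdForm.antidiagonal 3).over K)) : GL (Fin 3) K) : Matrix (Fin 3) (Fin 3) K) - 1) *
        (((((u * κ)⁻¹ * γ * (u * κ) : unitaryGroupOfForm σ ((StdForm.antidiagonal 3).over K)) : GL (Fin 3) K) : Matrix (Fin 3) (Fin 3) K) - 1)) i j) ≤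
        Valued.v ϖ ^ (3 * 1 + 1) := fun {κ} hκ => by
    have h := (map_pow_le_scaleLattice_latticeGraphIso_root_iff hϖ γ (u * κ) (pow_ne_zero _ hϖ0) 3).1 (by rw [hframe hκ]; exact hnil1)
    simpa only [pow_three', map_pow] using h
  have hYne : ∀ {κ : unitaryGroupOfForm σ ((StdForm.antidiagonal 3).over K)}, κ ∈ unitaryInt σ ((StdForm.antidiagonal 3).over K) →
      ¬ ∀ i j, Valued.v ((((((u * κ)⁻¹ * γ * (u * κ) : unitaryGroupOfForm σ ((StdForm.antidiagonal 3).over K)) : GL (Fin 3) K) : Matrix (Fin 3) (Fin 3) K) - 1) i j) ≤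
        Valued.v ϖ ^ (1 + 1) := fun {κ} hκ h => by
    apply hlev2
    have h' := (map_pow_le_scaleLattice_latticeGraphIso_root_iff hϖ γ (u * κ) (pow_ne_zero (1 + 1) hϖ0) 1).2 (by simpa only [pow_one, map_pow] using h)
    rwa [pow_one, hframe hκ] at h'
  -- ORIENTATION: the inward side `p = (uκ₀)·N₁`, `g = latt((uκ₀)·g(a₀,b₀))`
  obtain ⟨κ₀, hκ₀, a₀, b₀, ha₀, hb₀, hp_eq, hg_eq⟩ := exists_frame_of_adj_adj hσ hvσ hσϖ hϖ hres h2 u rfl hp hg hgv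
  set γ₀ : unitaryGroupOfForm σ ((StdForm.antidiagonal 3).over K) := (u * κ₀)⁻¹ * γ * (u * κ₀) with hγ₀def
  have hM₀ : (((γ₀ : GL (Fin 3) K) : Matrix (Fin 3) (Fin 3) K) - 1) = (((((u * κ₀ : unitaryGroupOfForm σ ((StdForm.antidiagonal 3).over K)) : GL (Fin 3) K)⁻¹ : GL (Fin 3) K) : Matrix (Fin 3) (Fin 3) K) * (((γ : GL (Fin 3) K) : Matrix (Fin 3) (Fin 3) K) - 1) * (((u * κ₀ : unitaryGroupOfForm σ ((StdForm.antidiagonal 3).over K)) : GL (Fin 3) K) : Matrix (Fin 3) (Fin 3) K)) :=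
    coe_inv_mul_mul_sub_one γ (u * κ₀)
  have hY₀ := hY hκ₀
  have hY₀3 := hY3 hκ₀
  have hY₀2ne := hY2ne hκ₀
  -- the inward line is in the kernel: ★ J §1 (eigenline from `hup`) + §2 (nilpotency)
  have hcol₀ : ∀ i, Valued.v ((((γ₀ : GL (Fin 3) K) : Matrix (Fin 3) (Fin 3) K) - 1) i 0) ≤ Valued.v ϖ ^ (1 + 1) := by
    have hup' := hup1
    rw [hg_eq] at hup'
    have hM₀' : ∀ i j, Valued.v ((((((u * κ₀ : unitaryGroupOfForm σ ((StdForm.antidiagonal 3).over K)) : GL (Fin 3) K)⁻¹ : GL (Fin 3) K) : Matrix (Fin 3) (Fin 3) K) * (((γ : GL (Fin 3) K) : Matrix (Fin 3) (Fin 3) K) - 1) * (((u * κ₀ : unitaryGroupOfForm σ ((StdForm.antidiagonal 3).over K)) : GL (Fin 3) K) : Matrix (Fin 3) (Fin 3) K)) i j) ≤ Valued.v ϖ ^ 1 := fun i j => by rw [← hM₀]; exact hY₀ i j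
    obtain ⟨h10, -, h20⟩ := v_apply_le_succ_of_map_sub_one_childLatt_le hϖ ((u * κ₀ : unitaryGroupOfForm σ ((StdForm.antidiagonal 3).over K)) : GL (Fin 3) K)
      (γ : GL (Fin 3) K) ha₀ hb₀ hd1 hM₀' hup'
    have hcube' : ∀ i j, Valued.v (((((((u * κ₀ : unitaryGroupOfForm σ ((StdForm.antidiagonal 3).over K)) : GL (Fin 3) K)⁻¹ : GL (Fin 3) K) : Matrix (Fin 3) (Fin 3) K) * (((γ : GL (Fin 3) K) : Matrix (Fin 3) (Fin 3) K) - 1) * (((u * κ₀ : unitaryGroupOfForm σ ((StdForm.antidiagonal 3).over K)) : GL (Fin 3) K) : Matrix (Fin 3) (Fin 3) K)) * (((((u * κ₀ : unitaryGroupOfForm σ ((StdForm.antidiagonal 3).over K)) : GL (Fin 3) K)⁻¹ : GL (Fin 3) K) : Matrix (Fin 3) (Fin 3) K) * (((γ : GL (Fin 3) K) : Matrix (Fin 3) (Fin 3) K) - 1) * (((u * κ₀ : unitaryGroupOfForm σ ((StdForm.antidiagonal 3).over K)) : GL (Fin 3) K) : Matrix (Fin 3) (Fin 3) K)) * (((((u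 * κ₀ : unitaryGroupOfForm σ ((StdForm.antidiagonal 3).over K)) : GL (Fin 3) K)⁻¹ : GL (Fin 3) K) : Matrix (Fin 3) (Fin 3) K) * (((γ : GL (Fin 3) K) : Matrix (Fin 3) (Fin 3) K) - 1) * (((u * κ₀ : unitaryGroupOfForm σ ((StdForm.antidiagonal 3).over K)) : GL (Fin 3) K) : Matrix (Fin 3) (Fin 3) K))) i j) ≤ Valued.v ϖ ^ (3 * 1 + 1) := fun i j => by
      rw [← hM₀]; exact hY₀3 i j
    have hall : ∀ i, Valued.v ((((((u * κ₀ : unitaryGroupOfForm σ ((StdForm.antidiagonal 3).over K)) : GL (Fin 3) K)⁻¹ : GL (Fin 3) K) : Matrix (Fin 3) (Fin 3) K) * (((γ : GL (Fin 3) K) : Matrix (Fin 3) (Fin 3) K) - 1) * (((u * κ₀ : unitaryGroupOfForm σ ((StdForm.antidiagonal 3).over K)) : GL (Fin 3) K) : Matrix (Fin 3) (Fin 3) K)) i 0) ≤ Valued.v ϖ ^ (1 + 1) := by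
      by_contra hnot
      have hpiv := v_one_zero_eq_of_cube_le_of_corner hϖ hM₀' hcube' h20 hnot
      have hlt : Valued.v ϖ ^ (1 + 1) < Valued.v ϖ ^ 1 := by
        rw [pow_succ]; exact mul_lt_of_lt_one_right (zero_lt_iff.2 (pow_ne_zero _ hvϖ0)) hϖlt
      exact (lt_irrefl _) ((h10.trans_lt hlt).trans_eq hpiv.symm)
    intro i; rw [hM₀]; exact hall i
  -- the ODD REGULAR SHAPE in the frame `u₀`: pivots `|Y₀ 1 2| = |Y₀ 0 1| = |ϖ|`, every entry off `{(0,1),(1,2),(0,2)}` small (★ M, odd versions)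
  obtain ⟨h12, h01⟩ := v_coe_sub_one_one_two_eq_of_odd_of_col_of_sq hvσ hσϖ hϖ hres γ₀ hodd hY₀ hcol₀ hY₀3 hY₀2ne
  have hshape : ∀ i j : Fin 3, ¬ (i = 0 ∧ j = 1) → ¬ (i = 1 ∧ j = 2) → ¬ (i = 0 ∧ j = 2) →
      Valued.v ((((γ₀ : GL (Fin 3) K) : Matrix (Fin 3) (Fin 3) K) - 1) i j) ≤ Valued.v ϖ ^ (1 + 1) :=
    (forall_v_coe_sub_one_le_succ_of_odd_of_col hvσ hσϖ hϖ hres γ₀ hodd hY₀ hcol₀ hY₀3).1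
  refine ⟨?_, ?_⟩
  · -- LABELS of a grandchild: `¬ LEV[w] ϖ`
    rintro w ⟨c, ⟨hvc, hdc, -⟩, hcw, hdw, hwfix⟩
    have hne : w ≠ latticeGraphIso σ ϖ ((StdForm.antidiagonal 3).over K) u ⟨stdLattice K 3, 0, isSelfDualLattice_stdLattice_three_of_v hϖ⟩ := by
      intro h; rw [h] at hdw; omega
    obtain ⟨κ, hκ, a, b, ha, hb, hc_eq, hw_eq⟩ := exists_frame_of_adj_adj hσ hvσ hσϖ hϖ hres h2 u rfl hvc hcw hne
    -- `c ≠ p` (outward vs inward), so `k := κ₀⁻¹κ` moves `N₁`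
    have hcp : c ≠ p := by intro h; rw [h] at hdc; omega
    set k : unitaryGroupOfForm σ ((StdForm.antidiagonal 3).over K) := κ₀⁻¹ * κ with hkdef
    have hk : k ∈ unitaryInt σ ((StdForm.antidiagonal 3).over K) := Subgroup.mul_mem _ (Subgroup.inv_mem _ hκ₀) hκ
    have hkN : ¬ Valued.v (((k : GL (Fin 3) K) : Matrix (Fin 3) (Fin 3) K) 2 0) < 1 := by
      intro hlt
      have hkN₁ := (mapGL_N₁_eq_iff_v_apply_two_zero_lt_one hvσ hϖ hk).2 hlt
      apply hcp
      rw [hc_eq, hp_eq, show u * κ = u * κ₀ * k by rw [hkdef, mul_assoc, mul_inv_cancel_left], latticeGraphIso_mul_apply]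
      congr 1
      exact Subtype.ext (by rw [latticeGraphIso_apply_val]; exact hkN₁)
    -- the matrix in the frame `uκ = u₀k` is `k⁻¹Y₀k`
    have hconj : (u * κ)⁻¹ * γ * (u * κ) = k⁻¹ * γ₀ * k := by
      rw [hγ₀def, show u * κ = u * κ₀ * k by rw [hkdef, mul_assoc, mul_inv_cancel_left]]
      exact conj_mul_eq_inv_mul_conj_mul γ (u * κ₀) k
    have hMk : (((((u * κ : unitaryGroupOfForm σ ((StdForm.antidiagonal 3).over K)) : GL (Fin 3) K)⁻¹ : GL (Fin 3) K) : Matrix (Fin 3) (Fin 3) K) * (((γ : GL (Fin 3) K) : Matrix (Fin 3) (Fin 3) K) - 1) * (((u * κ : unitaryGroupOfForm σ ((StdForm.antidiagonal 3).over K)) : GL (Fin 3) K) : Matrix (Fin 3) (Fin 3) K)) =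
        (((k : GL (Fin 3) K)⁻¹ : GL (Fin 3) K) : Matrix (Fin 3) (Fin 3) K) * (((γ₀ : GL (Fin 3) K) : Matrix (Fin 3) (Fin 3) K) - 1) * ((k : GL (Fin 3) K) : Matrix (Fin 3) (Fin 3) K) := by
      rw [← coe_inv_mul_mul_sub_one γ (u * κ), ← coe_inv_mul_mul_sub_one γ₀ k, hconj]
    -- level `ϖ` in the frame `uκ`
    have hM : ∀ i j, Valued.v ((((((u * κ : unitaryGroupOfForm σ ((StdForm.antidiagonal 3).over K)) : GL (Fin 3) K)⁻¹ : GL (Fin 3) K) : Matrix (Fin 3) (Fin 3) K) * (((γ : GL (Fin 3) K) : Matrix (Fin 3) (Fin 3) K) - 1) * (((u * κ : unitaryGroupOfForm σ ((StdForm.antidiagonal 3).over K)) : GL (Fin 3) K) : Matrix (Fin 3) (Fin 3) K)) i j) ≤ Valued.v ϖ ^ 1 := fun i j => by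
      rw [← coe_inv_mul_mul_sub_one γ (u * κ)]; exact hY hκ i j
    -- NOT KERNEL: the first column of `k⁻¹Y₀k` does not vanish residually (★ M₂)
    have hcol : ¬ ∀ i, Valued.v ((((((u * κ : unitaryGroupOfForm σ ((StdForm.antidiagonal 3).over K)) : GL (Fin 3) K)⁻¹ : GL (Fin 3) K) : Matrix (Fin 3) (Fin 3) K) * (((γ : GL (Fin 3) K) : Matrix (Fin 3) (Fin 3) K) - 1) * (((u * κ : unitaryGroupOfForm σ ((StdForm.antidiagonal 3).over K)) : GL (Fin 3) K) : Matrix (Fin 3) (Fin 3) K)) i 0) ≤ Valued.v ϖ ^ (1 + 1) := by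
      rw [hMk]
      exact fun h => hkN ((forall_v_conj_apply_zero_le_succ_iff hvσ hϖ hY₀ hshape h12 h01 hk).1 h)
    -- the CORNER passes: `w` is FIXED, so `LEV[w](ϖ⁰)` (★ H dictionary at `d = 1`)
    have h20 : Valued.v ((((((u * κ : unitaryGroupOfForm σ ((StdForm.antidiagonal 3).over K)) : GL (Fin 3) K)⁻¹ : GL (Fin 3) K) : Matrix (Fin 3) (Fin 3) K) * (((γ : GL (Fin 3) K) : Matrix (Fin 3) (Fin 3) K) - 1) * (((u * κ : unitaryGroupOfForm σ ((StdForm.antidiagonal 3).over K)) : GL (Fin 3) K) : Matrix (Fin 3) (Fin 3) K)) 2 0) ≤ Valued.v ϖ ^ (1 + 1) := by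
      have hlev0 := map_sub_one_le_scaleLattice_pow_zero_of_latticeGraphIso_eq γ hwfix
      rw [hw_eq] at hlev0
      exact (map_sub_one_childLatt_le_scaleLattice_pred_iff hϖ ((u * κ : unitaryGroupOfForm σ ((StdForm.antidiagonal 3).over K)) : GL (Fin 3) K)
        (γ : GL (Fin 3) K) ha hb hd1 hM).1 hlev0
    -- the tokens of `v` at `latt (uκ)`
    have hlev' : (latt (((u * κ : unitaryGroupOfForm σ ((StdForm.antidiagonal 3).over K)) : GL (Fin 3) K) : Matrix (Fin 3) (Fin 3) K)).map
          ((Matrix.toLin' (((γ : GL (Fin 3) K) : Matrix (Fin 3) (Fin 3) K) - 1)).restrictScalars 𝒪[K]) ≤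
        scaleLattice (ϖ ^ 1) (latt (((u * κ : unitaryGroupOfForm σ ((StdForm.antidiagonal 3).over K)) : GL (Fin 3) K) : Matrix (Fin 3) (Fin 3) K)) := by
      have h := hlev1
      rw [← hframe hκ] at h
      exact h
    have hnil' : (latt (((u * κ : unitaryGroupOfForm σ ((StdForm.antidiagonal 3).over K)) : GL (Fin 3) K) : Matrix (Fin 3) (Fin 3) K)).map
          ((Matrix.toLin' ((((γ : GL (Fin 3) K) : Matrix (Fin 3) (Fin 3) K) - 1) ^ 3)).restrictScalars 𝒪[K]) ≤
        scaleLattice (ϖ ^ (3 * 1 + 1)) (latt (((u * κ : unitaryGroupOfForm σ ((StdForm.antidiagonal 3).over K)) : GL (Fin 3) K) : Matrix (Fin 3) (Fin 3) K)) := by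
      have h := hnil1
      rw [← hframe hκ] at h
      exact h
    obtain ⟨hnotlev, -⟩ := not_lev_and_not_lev₂_childLatt_of_cube_le hvσ hϖ (u * κ) γ ha hb hd1 hlev' hnil' h20 hcol
    rw [pow_one] at hnotlev
    rw [hw_eq]
    exact hnotlev
  · -- COUNT: `#GC = q · #passing children`, `#passing children + 1 = #passing neighbours = #null lines = 2`
    have hGC := ncard_fixedGrandchildren_eq_mul_ncard_passingChildren hσ hvσ hσϖ hϖ hres h2 hT hv hvr hfix hlev
    have hpc := ncard_passingChildren_add_one_eq_ncard_passingNeighbors hσ hvσ hσϖ hϖ hres h2 hT hγ0 hv hvr hfix hlev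
    have hnull := ncard_neighborSet_null_eq_two_of_tokens hσ hvσ hσϖ hϖ hres h2 γ u hodd hlev1 hrk1 hnil1
    rw [setOf_passingNeighbors_eq_setOf_nullLine hσ hvσ hσϖ hϖ hres h2 γ u hfix hlev1, hnull] at hpc
    rw [hGC, show ({c | (latticeGraph σ ϖ ((StdForm.antidiagonal 3).over K)).Adj (latticeGraphIso σ ϖ ((StdForm.antidiagonal 3).over K) u ⟨stdLattice K 3, 0, isSelfDualLattice_stdLattice_three_of_v hϖ⟩) c ∧
          (latticeGraph σ ϖ ((StdForm.antidiagonal 3).over K)).dist ⟨stdLattice K 3, 0, isSelfDualLattice_stdLattice_three_of_v hϖ⟩ c =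
            (latticeGraph σ ϖ ((StdForm.antidiagonal 3).over K)).dist ⟨stdLattice K 3, 0, isSelfDualLattice_stdLattice_three_of_v hϖ⟩ (latticeGraphIso σ ϖ ((StdForm.antidiagonal 3).over K) u ⟨stdLattice K 3, 0, isSelfDualLattice_stdLattice_three_of_v hϖ⟩) + 1 ∧
          ∀ w ∈ (latticeGraph σ ϖ ((StdForm.antidiagonal 3).over K)).neighborSet c, latticeGraphIso σ ϖ ((StdForm.antidiagonal 3).over K) γ w = w} : Set _).ncard = 1 by omega, mul_one]

end Literature.NumberTheory.Automorphic.UnitaryLatticeTree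

end
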